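import Summits.QuantumFields.YangMills.Theorems.UnitScaleTiltProp7BlendedGauge
import Summits.QuantumFields.YangMills.Theorems.UnitScaleTiltProp7CompactChart
import HarnessLib

/-!
# Route `UnitScaleTilt`, crux K1 child «MinimiserStabilityRegPr» (stmt-QuantumFields-19200), line «route-R», stub P — THE ABSOLUTE ℓ² CLOSENESS OF THE
# ℓ²-OPTIMAL PINNED REPRESENTATIVE IS ALREADY A THEOREM (OWNER VET remark R-iii on the route-R pen v2, «Thm-2-LITE inside P»)

Cell `ym3-torus` ∕ fleet seat `ym-ust-19200-p1` (gen 10; HUMAN RULING D-0037, YM ladder rung R3).  WHY.  Stub P of the route-R pen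
(`RouteR.stub_relPoincareOpt`, registered as the second line of 19200) asks, for a reading-R2 critical `U ∈ (6)(ε₀) ∩ 𝔅_k(V)`, an ARBITRARY competitor
`W ∈ (6)(ε₀) ∩ 𝔅_k(V)` and an `ℓ²`-optimal `g` with `g↓ = 1`, the RELATIVE bound `Σ_b‖(W^g)_bU_b* − 1‖² ≤ C_P·L^{2(K−n)}·Σ_p‖W^g(∂p)U(∂p)^* − 1‖²`.  The owner's vet
(ym3-torus-plan g24, 01:06Z) observed that, since `‖W^g(∂p)U(∂p)^* − 1‖ ≤ 2ε₀L^{−2(K−n)}` on the regular fibre, P CONTAINS the absolute statement «every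
regular configuration of the fibre is ℓ²-close to `U` in the optimal pinned gauge, mean square `O(ε₀²L^{−2(K−n)})` per bond» — the `ℓ²` shadow of
[Balaban1985RegularSpaces] Thm 2's chart (16).  THIS FILE RECORDS THAT THE ABSOLUTE STATEMENT IS ALREADY IN THE TREE, with a sup bound: gen 9's blended comb gauge
(`Prop7BlendedGauge.exists_blendedGauge_T3`, p582247: for `U ∈ 𝔘_k(e₀) ∩ 𝔅_k(V)`, `W ∈ 𝔘_k(ε₀) ∩ 𝔅_k(V)`, `L ≥ 7` and absolute smallness of `ε₀, e₀`, a `g`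
with `g↓ = 1` and `‖(W^g)_bU_b* − 1‖ ≤ 551088(ε₀ + e₀)L^{−(K−n)}` on EVERY bond) is a competitor in the minimisation defining the optimal representative
(`Prop7CompactChart.exists_optimalRepr`), so every `ℓ²`-optimal `g` has `Σ_b‖(W^g)_bU_b* − 1‖² ≤ #bonds·(551088(ε₀ + e₀)L^{−(K−n)})²` — no criticality, no
chart, no Green's function.  Hence the CONTENT of P is the relative (homogeneous) inequality alone; the absolute closeness costs nothing.

WHAT IS PROVED (sorry-free, no definition).  **`sum_normSq_pertVar_optimal_le_T3`** (the bound for every optimal `g`), `sum_normSq_pertVar_optimal_le_card_T3`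
(the `#bonds·s²` form).

HONEST SCOPE.  A ten-line composition of p582247 with optimality; count-neutral helper toward stmt-QuantumFields-19200 (`--supports`).  Not a claim about the
continuum limit or the mass gap.

References: T. Bałaban, CMP 102 (1985) 277–309 [Balaban1985Variational] ((4) p.278, (16) p.280, Prop. 7 p.299); CMP 99 (1985) 75–102
[Balaban1985RegularSpaces] (Thm 2 p.83).
-/

noncomputable section

open scoped BigOperators Matrix.Norms.L2Operator Matrix

namespace Summit.QuantumFields.YangMills.Theorems.Prop7OptimalApriori

open Literature.MathematicalPhysics.QuantumFieldTheory.Balaban1983to89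
open Literature.MathematicalPhysics.QuantumFieldTheory.Balaban1983to89.T3ContinuumYM3Torus
open Literature.MathematicalPhysics.QuantumFieldTheory.Balaban1983to89.T3PrintedRegularMinimiser (regFibrePr)
open Literature.MathematicalPhysics.QuantumFieldTheory.Balaban1983to89.T3PrintedRegularOrbits (descTransf)
open BlockAveragingEMLLinearisedBackground (pertVar)
open Summit.QuantumFields.YangMills.Theorems.Prop7BlendedGauge (exists_blendedGauge_T3)

variable (F : T3Family) {n K : ℕ} (h : n ≤ K)

/-- **EVERY `ℓ²`-OPTIMAL PINNED REPRESENTATIVE IS ABSOLUTELY ℓ²-CLOSE TO THE BACKGROUND** (d = 3 carrier, `L ≥ 7`, absolute smallness of the radii): for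
`U ∈ 𝔘_k(e₀) ∩ 𝔅_k(V)`, `W ∈ 𝔘_k(ε₀) ∩ 𝔅_k(V)` and every `g` with `g↓ = 1` minimising `Σ_b‖(W^v)_bU_b⁻¹ − 1‖²` over `v↓ = 1`:
`Σ_b‖(W^g)_bU_b⁻¹ − 1‖² ≤ Σ_b (551088(ε₀ + e₀)L^{−(K−n)})²` (the blended comb gauge of gen 9 is a competitor).  No criticality of either configuration.
[cite: Balaban1985Variational, (4) p.278, (16) p.280] -/
theorem sum_normSq_pertVar_optimal_le_T3 (hL : 7 ≤ F.L) {ε₀ e₀ : ℝ}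
    (hε : 50 * (500 * (F.L : ℝ) + 7 * (F.L : ℝ) ^ 2) * ε₀ ≤ 1) (he : 50 * (500 * (F.L : ℝ) + 7 * (F.L : ℝ) ^ 2) * e₀ ≤ 1)
    (hsmall : 538800 * (ε₀ + e₀) ≤ 1)
    {V : GaugeField (F.P n) 0 (Matrix.specialUnitaryGroup (Fin 2) ℂ)} (U W : GaugeField (F.P K) 0 (Matrix.specialUnitaryGroup (Fin 2) ℂ))
    (hU : U ∈ regFibrePr F n K h e₀ V) (hW : W ∈ regFibrePr F n K h ε₀ V)
    {g : GaugeTransf (F.P K) 0 (Matrix.specialUnitaryGroup (Fin 2) ℂ)}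
    (hopt : ∀ v : GaugeTransf (F.P K) 0 (Matrix.specialUnitaryGroup (Fin 2) ℂ), descTransf F n K h v = (fun _ => 1) →
      ∑ b : PBond (F.P K) 0, ‖pertVar U (GaugeField.gaugeAct g W) b‖ ^ 2 ≤ ∑ b : PBond (F.P K) 0, ‖pertVar U (GaugeField.gaugeAct v W) b‖ ^ 2) :
    ∑ b : PBond (F.P K) 0, ‖pertVar U (GaugeField.gaugeAct g W) b‖ ^ 2 ≤
      ∑ _b : PBond (F.P K) 0, (551088 * (ε₀ + e₀) * (((F.L : ℝ))⁻¹) ^ (K - n)) ^ 2 := by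
  obtain ⟨v, hv4, -, hsup⟩ := exists_blendedGauge_T3 F h hL hε he hsmall U W hU hW
  refine (hopt v hv4).trans (Finset.sum_le_sum fun b _ => ?_)
  exact pow_le_pow_left₀ (norm_nonneg _) (hsup b) 2

/-- The same with the bond count displayed: `Σ_b‖(W^g)_bU_b⁻¹ − 1‖² ≤ #bonds · (551088(ε₀ + e₀)L^{−(K−n)})²` — mean square `O((ε₀+e₀)²L^{−2(K−n)})` per bond.
[cite: Balaban1985Variational, (4) p.278, (16) p.280] -/
theorem sum_normSq_pertVar_optimal_le_card_T3 (hL : 7 ≤ F.L) {ε₀ e₀ : ℝ}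
    (hε : 50 * (500 * (F.L : ℝ) + 7 * (F.L : ℝ) ^ 2) * ε₀ ≤ 1) (he : 50 * (500 * (F.L : ℝ) + 7 * (F.L : ℝ) ^ 2) * e₀ ≤ 1)
    (hsmall : 538800 * (ε₀ + e₀) ≤ 1)
    {V : GaugeField (F.P n) 0 (Matrix.specialUnitaryGroup (Fin 2) ℂ)} (U W : GaugeField (F.P K) 0 (Matrix.specialUnitaryGroup (Fin 2) ℂ))
    (hU : U ∈ regFibrePr F n K h e₀ V) (hW : W ∈ regFibrePr F n K h ε₀ V)
    {g : GaugeTransf (F.P K) 0 (Matrix.specialUnitaryGroup (Fin 2) ℂ)}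
    (hopt : ∀ v : GaugeTransf (F.P K) 0 (Matrix.specialUnitaryGroup (Fin 2) ℂ), descTransf F n K h v = (fun _ => 1) →
      ∑ b : PBond (F.P K) 0, ‖pertVar U (GaugeField.gaugeAct g W) b‖ ^ 2 ≤ ∑ b : PBond (F.P K) 0, ‖pertVar U (GaugeField.gaugeAct v W) b‖ ^ 2) :
    ∑ b : PBond (F.P K) 0, ‖pertVar U (GaugeField.gaugeAct g W) b‖ ^ 2 ≤
      (Fintype.card (PBond (F.P K) 0) : ℝ) * (551088 * (ε₀ + e₀) * (((F.L : ℝ))⁻¹) ^ (K - n)) ^ 2 := by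
  have h1 := sum_normSq_pertVar_optimal_le_T3 F h hL hε he hsmall U W hU hW hopt
  rwa [Finset.sum_const, Finset.card_univ, nsmul_eq_mul] at h1

end Summit.QuantumFields.YangMills.Theorems.Prop7OptimalApriori

end
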